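import Literature.Algebra.EuclideanLattices.ARVerifier
import Literature.Algebra.EuclideanLattices.DualGaussianSampling
import Literature.Algebra.EuclideanLattices.LatticeGapCVPNPcoNP
import Mathlib.LinearAlgebra.Matrix.Adjugate
import Mathlib.Analysis.Real.Pi.Bounds
import Mathlib.Analysis.Complex.ExponentialBounds
import HarnessLib

/-!
# Completeness of the integer-arithmetic Aharonov–Regev verifier: far points have accepted certificates

Topic `Algebra/EuclideanLattices` (family `pqc`; serves the decomposition of Aharonov–Regev 2005,
Thm. 1.1, coNP part = `gapCVP_sqrt_mem_promiseCoNP`). Everything PROVED. With the soundness theorem of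
`ARVerifier.lean` (`not_accepts_of_infDist_le`) this file completes the MATHEMATICS of the integer
verifier variant `ARVerifier.Accepts`: what remains for the leaf is machine-level (the language of
accepted pairs is in `P`) plus the polynomial bound on the certificate's bit size.

## The printed completeness (§6.2, pp. 11–12 of the preprint `lit read paper:doi-10-1109-focs-2004-35`)

"Suppose `v` is a YES instance [far from `L`] … a random witness chosen according to `f̂` satisfies
each of the above tests with probability at least `3/4`": Claim 6.1 (test (a), by Lemma 3.1 and the
pointwise approximation Lemma 1.3), Lemma 6.3 (test (c), by Lemmas 2.5, 2.6 and the net Lemma 6.2).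

## What is proved here (for the tree's variant, constants differ from print)

* `certOf I t ω` — the certificate built from dual samples `ω : Fin N → L(B)*`: `C = adj B`,
  `D = det B`, `aⱼ = B wⱼ ∈ ℤⁿ` (`dualCoords`, integrality from `mem_dualLattice`), `mⱼ = round ⟪t, wⱼ⟫`;
  its arithmetic: `C aⱼ = det B · wⱼ` (`castVec_dualNum_certOf`), `εⱼ = det B (⟪t, wⱼ⟫ − round ⟪t, wⱼ⟫)`,
  `|εⱼ| = |det B| ‖⟪t, wⱼ⟫‖_{ℝ/ℤ}`, the sample matrix is `det B · W`.
* `accepts_certOf` — checks 1, 2 hold by construction; check 3 from `∑ⱼ ‖⟪t, wⱼ⟫‖² ≥ N/50`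
  (`check3_certOf`); check 5 (the trace test) from an operator bound `∑ⱼ ⟪u, wⱼ⟫² ≤ λ‖u‖²`,
  `λ ≤ 2N/(100d)²`, via `trace ((W Wᵀ)^k) ≤ n λ^k < (2λ)^k` (`trace_pow_le_card_mul_pow`,
  `ARVerifierAlgebra.lean`; `n < 2^k`) (`check5_certOf`).
* `exists_accepts_of_far` — **for every NO instance of `GapCVP_{200√n}` (`B` nonsingular, `d > 0`,
  `dist(t, L(B)) > 200 √n d`) some certificate is accepted**: AR Lemma 3.1 gives
  `f_{100d}(t) ≤ (2√(2πe) e^{-4π})ⁿ ≤ 2⁻¹³` (`GaussianLatticeTails.lean`); good sample tuples exist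
  (`exists_good_dualSamples`, `DualGaussianSampling.lean`, with `c = 3`, `a = N/100`, `√θ = N/(2s²)`,
  `s = 100d`, `N = nSamples n = 3000(n+1)⁴`; budget `≤ 1/100 + 53/1000 + 108/1000 < 1`), giving
  `∑ⱼ ‖⟪t, wⱼ⟫‖² > N((1 − 2⁻¹³)/(2π²) − 1/100) ≥ N/50` and, by `sum_inner_sq_le_of_good`,
  `λ = N(π/8 + 1/2)/s² ≤ 2N/s²`.
* The numerical constants (`√(2πe) ≤ 5`, `2√(2πe)e^{-4π} ≤ 2⁻¹³`, `3√(2πe)e^{-9π} ≤ 2⁻³⁴`,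
  `3000(n+1)⁴ 2^{-34n} ≤ 1/100`).

Not here: the bit size of `certOf` (entries bounded through `‖wⱼ‖ < 3√n/(100d)`, Hadamard-type
bounds for `adj B`, `det B`) and the machine; the assembly to `gapCVP_sqrt_mem_promiseCoNP`.

## References

* D. Aharonov, O. Regev, *Lattice problems in NP ∩ coNP*, J. ACM 52 (2005) 749–765, §6.2
  (Claim 6.1, Lemmas 6.2–6.3), Lemma 3.1.
-/

noncomputable section

open Matrix Metric MeasureTheory Module Literature.NumberTheory.Sieve.Vinogradov
open scoped Real InnerProductSpace

namespace Literature.Algebra.EuclideanLattices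

/-! ### From dual samples to an integer certificate -/

namespace ARVerifier

open Matrix Metric Literature.NumberTheory.Sieve.Vinogradov

variable {I : LatticeInstance}

/-- Coordinates of a vector of `ℝⁿ`. [folklore] -/
abbrev coords (w : EuclideanSpace ℝ (Fin I.n)) : Fin I.n → ℝ := WithLp.ofLp w

/-- The real inner product of `ℝⁿ` is the dot product of coordinates. [folklore] -/
theorem inner_eq_dotProduct (x y : EuclideanSpace ℝ (Fin I.n)) : ⟪x, y⟫_ℝ = coords x ⬝ᵥ coords y := by
  rw [EuclideanSpace.inner_eq_star_dotProduct, star_trivial, dotProduct_comm]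

/-- The coordinates of the target `t ∈ ℤⁿ` are `castVec t`. [folklore] -/
theorem coords_intVecToEuclidean (v : Fin I.n → ℤ) : coords (intVecToEuclidean I.n v) = castVec v := rfl

/-- **Dual lattice vectors have integer pairings with the basis rows**: `⟪bᵢ, w⟫ ∈ ℤ` for `w ∈ L(B)*`.
[cite: AharonovRegev2005, §2.1 (p. 6, the dual lattice)] -/
theorem exists_int_inner_vec (w : dualLattice I.lattice) (i : Fin I.n) : ∃ m : ℤ, (m : ℝ) = ⟪I.vec i, (w : EuclideanSpace ℝ (Fin I.n))⟫_ℝ := by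
  obtain ⟨m, hm⟩ := mem_dualLattice.1 w.2 (I.vec i) (Submodule.subset_span (Set.mem_range_self i))
  exact ⟨m, by rw [hm, real_inner_comm]⟩

/-- The integer coordinate vector `a = B w ∈ ℤⁿ` of a dual vector `w` (`aᵢ = ⟪bᵢ, w⟫`, an integer,
read off as `round`). [cite: AharonovRegev2005, §6 (p. 10) — variant] -/
def dualCoords (w : dualLattice I.lattice) : Fin I.n → ℤ := fun i ↦ round ⟪I.vec i, (w : EuclideanSpace ℝ (Fin I.n))⟫_ℝ

/-- `(B w)ᵢ = ⟪bᵢ, w⟫` exactly. [folklore] -/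
theorem cast_dualCoords (w : dualLattice I.lattice) (i : Fin I.n) :
    ((dualCoords w i : ℤ) : ℝ) = ⟪I.vec i, (w : EuclideanSpace ℝ (Fin I.n))⟫_ℝ := by
  obtain ⟨m, hm⟩ := exists_int_inner_vec w i
  rw [dualCoords, ← hm, round_intCast]

/-- `B w = a` in coordinates: `(B.map cast) *ᵥ coords w = castVec (dualCoords w)`. [folklore] -/
theorem basis_mulVec_coords (w : dualLattice I.lattice) :
    (I.basis.map (Int.castRingHom ℝ)) *ᵥ coords (w : EuclideanSpace ℝ (Fin I.n)) = castVec (dualCoords w) := by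
  ext i
  rw [castVec_apply, cast_dualCoords, inner_eq_dotProduct]
  simp only [mulVec, dotProduct, map_apply, coords]
  refine Finset.sum_congr rfl fun j _ ↦ ?_
  simp [LatticeInstance.vec_apply]

/-- Casting the determinant of the integer basis. [folklore] -/
theorem cast_det_basis (I : LatticeInstance) : ((I.basis.det : ℤ) : ℝ) = (I.basis.map (Int.castRingHom ℝ)).det := by
  rw [← eq_intCast (Int.castRingHom ℝ) I.basis.det, RingHom.map_det, RingHom.mapMatrix_apply]

/-- Casting the adjugate of the integer basis. [folklore] -/
theorem adjugate_map_basis (I : LatticeInstance) :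
    (I.basis.map (Int.castRingHom ℝ)).adjugate = I.basis.adjugate.map (Int.castRingHom ℝ) := by
  rw [← RingHom.mapMatrix_apply, ← RingHom.mapMatrix_apply, RingHom.map_adjugate]

/-- **The certificate built from samples**: `C = adj B`, `D = det B`, `aⱼ = B wⱼ`,
`mⱼ = round ⟪t, wⱼ⟫`. [cite: AharonovRegev2005, §6.2 (p. 11) — variant] -/
def certOf (I : LatticeInstance) (t : Fin I.n → ℤ) {N : ℕ} (ω : Fin N → dualLattice I.lattice) : Cert I.n N where
  C := I.basis.adjugate
  D := I.basis.det
  A := fun j ↦ dualCoords (ω j)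
  m := fun j ↦ round ⟪intVecToEuclidean I.n t, (ω j : EuclideanSpace ℝ (Fin I.n))⟫_ℝ

/-- **The numerators are `D` times the samples**: `C aⱼ = adj(B) B wⱼ = det(B) wⱼ`.
[cite: AharonovRegev2005, §6 (p. 10) — variant] -/
theorem castVec_dualNum_certOf (t : Fin I.n → ℤ) {N : ℕ} (ω : Fin N → dualLattice I.lattice) (j : Fin N) :
    castVec ((certOf I t ω).dualNum j) = (I.basis.det : ℝ) • coords (ω j : EuclideanSpace ℝ (Fin I.n)) := by
  have h1 : castVec ((certOf I t ω).dualNum j) = (I.basis.map (Int.castRingHom ℝ)).adjugate *ᵥ castVec (dualCoords (ω j)) := by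
    ext i
    rw [adjugate_map_basis]
    simp only [certOf, Cert.dualNum, castVec_apply, mulVec, dotProduct, map_apply, eq_intCast, Int.cast_sum, Int.cast_mul]
  rw [h1, ← basis_mulVec_coords, mulVec_mulVec, adjugate_mul, smul_mulVec, one_mulVec, cast_det_basis]

/-- The phase numerator: `eⱼ = D ⟪t, wⱼ⟫`. [folklore] -/
theorem cast_phaseNum_certOf (t : Fin I.n → ℤ) {N : ℕ} (ω : Fin N → dualLattice I.lattice) (j : Fin N) :
    (((certOf I t ω).phaseNum t j : ℤ) : ℝ) = (I.basis.det : ℝ) * ⟪intVecToEuclidean I.n t, (ω j : EuclideanSpace ℝ (Fin I.n))⟫_ℝ := by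
  rw [Cert.phaseNum, ← castVec_dotProduct, castVec_dualNum_certOf, dotProduct_smul, smul_eq_mul, inner_eq_dotProduct,
    coords_intVecToEuclidean]

/-- **The residuals are `D` times the rounding errors**: `εⱼ = D (⟪t, wⱼ⟫ − round ⟪t, wⱼ⟫)`, so
`|εⱼ| = |D| ‖⟪t, wⱼ⟫‖_{ℝ/ℤ}`. [cite: AharonovRegev2005, §6.2 — variant] -/
theorem cast_residual_certOf (t : Fin I.n → ℤ) {N : ℕ} (ω : Fin N → dualLattice I.lattice) (j : Fin N) :
    (((certOf I t ω).residual t j : ℤ) : ℝ) =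
      (I.basis.det : ℝ) * (⟪intVecToEuclidean I.n t, (ω j : EuclideanSpace ℝ (Fin I.n))⟫_ℝ -
        round ⟪intVecToEuclidean I.n t, (ω j : EuclideanSpace ℝ (Fin I.n))⟫_ℝ) := by
  rw [Cert.residual, Int.cast_sub, Int.cast_mul, cast_phaseNum_certOf]
  simp only [certOf]
  ring

/-- `|εⱼ| = |D| ‖⟪t, wⱼ⟫‖_{ℝ/ℤ}`. [folklore] -/
theorem abs_cast_residual_certOf (t : Fin I.n → ℤ) {N : ℕ} (ω : Fin N → dualLattice I.lattice) (j : Fin N) :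
    |(((certOf I t ω).residual t j : ℤ) : ℝ)| =
      |(I.basis.det : ℝ)| * distInt ⟪intVecToEuclidean I.n t, (ω j : EuclideanSpace ℝ (Fin I.n))⟫_ℝ := by
  rw [cast_residual_certOf, abs_mul, distInt]

/-- Check 2 holds for the built certificate: `|2 εⱼ| ≤ |D|`. [folklore] -/
theorem two_mul_residual_certOf_le (t : Fin I.n → ℤ) {N : ℕ} (ω : Fin N → dualLattice I.lattice) (j : Fin N) :
    |2 * (certOf I t ω).residual t j| ≤ |(certOf I t ω).D| := by
  have h : |(2 : ℝ) * (((certOf I t ω).residual t j : ℤ) : ℝ)| ≤ |((I.basis.det : ℤ) : ℝ)| := by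
    rw [abs_mul, abs_two, abs_cast_residual_certOf]
    have := distInt_le_half ⟪intVecToEuclidean I.n t, (ω j : EuclideanSpace ℝ (Fin I.n))⟫_ℝ
    have h0 := abs_nonneg ((I.basis.det : ℤ) : ℝ)
    nlinarith
  have h' : (((|2 * (certOf I t ω).residual t j| : ℤ) : ℝ)) ≤ ((|(certOf I t ω).D| : ℤ) : ℝ) := by
    push_cast
    simpa [certOf] using h
  exact_mod_cast h'

/-- **The sample matrix is `D · W`**: `sampleMatR (certOf …) = det(B) • W` with `W i j = (wⱼ)ᵢ`.
[folklore] -/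
theorem sampleMatR_certOf (t : Fin I.n → ℤ) {N : ℕ} (ω : Fin N → dualLattice I.lattice) :
    sampleMatR (certOf I t ω) = (I.basis.det : ℝ) • Matrix.of fun i j ↦ coords (ω j : EuclideanSpace ℝ (Fin I.n)) i := by
  ext i j
  have h := congrFun (castVec_dualNum_certOf t ω j) i
  simp only [castVec_apply, Pi.smul_apply, smul_eq_mul] at h
  simp only [sampleMatR, map_apply, Cert.sampleMat_apply, eq_intCast, Matrix.smul_apply, of_apply, smul_eq_mul]
  exact h


/-! ### The checks of `Accepts` for the built certificate -/

/-- **Check 3 (test (a''))** holds as soon as `∑ⱼ ‖⟪t, wⱼ⟫‖²_{ℝ/ℤ} ≥ N/50`. [cite: AharonovRegev2005, Claim 6.1 (p. 11) — variant] -/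
theorem check3_certOf (t : Fin I.n → ℤ) {N : ℕ} (ω : Fin N → dualLattice I.lattice)
    (h : (N : ℝ) / 50 ≤ ∑ j, distInt ⟪intVecToEuclidean I.n t, (ω j : EuclideanSpace ℝ (Fin I.n))⟫_ℝ ^ 2) :
    (N : ℤ) * (certOf I t ω).D ^ 2 ≤ 50 * ∑ j, (certOf I t ω).residual t j ^ 2 := by
  have hsq : ∀ j, (((certOf I t ω).residual t j : ℤ) : ℝ) ^ 2 =
      ((I.basis.det : ℤ) : ℝ) ^ 2 * distInt ⟪intVecToEuclidean I.n t, (ω j : EuclideanSpace ℝ (Fin I.n))⟫_ℝ ^ 2 := fun j ↦ by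
    rw [← sq_abs, abs_cast_residual_certOf, mul_pow, sq_abs]
  have hR : ((N : ℤ) : ℝ) * (((certOf I t ω).D : ℤ) : ℝ) ^ 2 ≤ 50 * ∑ j, (((certOf I t ω).residual t j : ℤ) : ℝ) ^ 2 := by
    simp_rw [hsq, ← Finset.mul_sum]
    have hD : (((certOf I t ω).D : ℤ) : ℝ) = ((I.basis.det : ℤ) : ℝ) := rfl
    rw [hD]
    have h0 : 0 ≤ ((I.basis.det : ℤ) : ℝ) ^ 2 := sq_nonneg _
    push_cast
    nlinarith [mul_le_mul_of_nonneg_left h h0]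
  exact_mod_cast hR

/-- The real witness matrix `W` (columns: the coordinates of the samples). [folklore] -/
def witnessMat {N : ℕ} (ω : Fin N → dualLattice I.lattice) : Matrix (Fin I.n) (Fin N) ℝ :=
  Matrix.of fun i j ↦ coords (ω j : EuclideanSpace ℝ (Fin I.n)) i

/-- `∑ⱼ ⟪u, wⱼ⟫² = uᵀ W Wᵀ u` in coordinates. [folklore] -/
theorem sum_inner_sq_eq_dotProduct_witnessMat {N : ℕ} (ω : Fin N → dualLattice I.lattice) (u : EuclideanSpace ℝ (Fin I.n)) :
    ∑ j, ⟪u, (ω j : EuclideanSpace ℝ (Fin I.n))⟫_ℝ ^ 2 = coords u ⬝ᵥ (witnessMat ω * (witnessMat ω)ᵀ) *ᵥ coords u := by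
  rw [dotProduct_mul_transpose_mulVec]
  refine Finset.sum_congr rfl fun j _ ↦ ?_
  rw [inner_eq_dotProduct]
  simp [dotProduct, witnessMat]

/-- **Check 5 (the trace test) from an operator bound**: if `∑ⱼ ⟪u, wⱼ⟫² ≤ λ ‖u‖²` for all `u` with
`0 ≤ λ ≤ 2N q²/(100 p)²` (`d = p/q`), then `(100p)^{2k} trace ((G Gᵀ)^k) ≤ (4N (qD)²)^k`:
`G = D·W`, `trace ((W Wᵀ)^k) ≤ n λ^k` (`trace_pow_le_card_mul_pow`) and `n < 2^k`.
[cite: AharonovRegev2005, Lemma 6.3 (p. 12) — variant] -/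
theorem check5_certOf (t : Fin I.n → ℤ) {d : ℚ} (hd : 0 < d) {N : ℕ} (ω : Fin N → dualLattice I.lattice) {lam : ℝ} (hlam0 : 0 ≤ lam)
    (hlam : lam ≤ 2 * N * ((d.den : ℕ) : ℝ) ^ 2 / (100 * ((d.num : ℤ) : ℝ)) ^ 2)
    (hop : ∀ u : EuclideanSpace ℝ (Fin I.n), ∑ j, ⟪u, (ω j : EuclideanSpace ℝ (Fin I.n))⟫_ℝ ^ 2 ≤ lam * ‖u‖ ^ 2) :
    (100 * d.num) ^ (2 * 2 ^ powSteps I.n) *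
        Matrix.trace (((certOf I t ω).sampleMat * (certOf I t ω).sampleMatᵀ) ^ 2 ^ powSteps I.n) ≤
      (4 * (N : ℤ) * ((d.den : ℤ) * (certOf I t ω).D) ^ 2) ^ 2 ^ powSteps I.n := by
  set k : ℕ := 2 ^ powSteps I.n with hk
  have hp : 0 < ((d.num : ℤ) : ℝ) := by exact_mod_cast Rat.num_pos.2 hd
  have hq : 0 < ((d.den : ℕ) : ℝ) := by exact_mod_cast d.den_pos
  -- the operator bound in coordinates
  have hopW : ∀ u : Fin I.n → ℝ, u ⬝ᵥ (witnessMat ω * (witnessMat ω)ᵀ) *ᵥ u ≤ lam * (u ⬝ᵥ u) := by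
    intro u
    have h := hop (WithLp.toLp 2 u)
    rw [sum_inner_sq_eq_dotProduct_witnessMat, EuclideanSpace.norm_eq, Real.sq_sqrt (Finset.sum_nonneg fun i _ ↦ sq_nonneg _)] at h
    simpa [dotProduct, coords, sq] using h
  -- `trace ((W Wᵀ)^k) ≤ n λ^k ≤ (2λ)^k`
  have hkeven : k = 2 * 2 ^ (powSteps I.n - 1) := by
    rw [hk, ← pow_succ']
    congr 1
    have := one_le_powSteps I.n
    omega
  have htrW : Matrix.trace ((witnessMat ω * (witnessMat ω)ᵀ) ^ k) ≤ (2 * lam) ^ k := by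
    have h := trace_pow_le_card_mul_pow (transpose_mul_transpose_self (witnessMat ω))
      (dotProduct_mul_transpose_mulVec_nonneg (witnessMat ω)) hlam0 hopW (2 ^ (powSteps I.n - 1))
    rw [← hkeven, Fintype.card_fin] at h
    refine h.trans ?_
    rw [mul_pow]
    refine mul_le_mul_of_nonneg_right ?_ (pow_nonneg hlam0 _)
    have hn : (I.n : ℝ) < 2 ^ k := by
      rw [hk]
      have := lt_two_pow_powSteps I.n
      have h2 : (I.n : ℝ) < ((2 ^ powSteps I.n : ℕ) : ℝ) := by exact_mod_cast this
      refine h2.trans_le ?_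
      push_cast
      exact_mod_cast Nat.pow_le_pow_right two_pos (Nat.lt_two_pow_self).le
    exact hn.le
  -- cast the integer test to `ℝ`
  have hD : sampleMatR (certOf I t ω) = ((I.basis.det : ℤ) : ℝ) • witnessMat ω := sampleMatR_certOf t ω
  have hcastTr : ((Matrix.trace (((certOf I t ω).sampleMat * (certOf I t ω).sampleMatᵀ) ^ k) : ℤ) : ℝ) =
      (((I.basis.det : ℤ) : ℝ) ^ 2) ^ k * Matrix.trace ((witnessMat ω * (witnessMat ω)ᵀ) ^ k) := by
    rw [cast_trace_sampleMat_pow, hD, Matrix.smul_mul, Matrix.transpose_smul, Matrix.mul_smul, smul_smul, ← sq, smul_pow,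
      Matrix.trace_smul, smul_eq_mul]
  have hR : (100 * ((d.num : ℤ) : ℝ)) ^ (2 * k) *
      ((((I.basis.det : ℤ) : ℝ) ^ 2) ^ k * Matrix.trace ((witnessMat ω * (witnessMat ω)ᵀ) ^ k)) ≤
      (4 * (N : ℝ) * (((d.den : ℕ) : ℝ) * ((I.basis.det : ℤ) : ℝ)) ^ 2) ^ k := by
    have hΛ : (100 * ((d.num : ℤ) : ℝ)) ^ 2 * (2 * lam) ≤ 4 * (N : ℝ) * ((d.den : ℕ) : ℝ) ^ 2 := by
      rw [le_div_iff₀ (by positivity)] at hlam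
      linarith
    calc (100 * ((d.num : ℤ) : ℝ)) ^ (2 * k) * ((((I.basis.det : ℤ) : ℝ) ^ 2) ^ k * Matrix.trace ((witnessMat ω * (witnessMat ω)ᵀ) ^ k))
        ≤ (100 * ((d.num : ℤ) : ℝ)) ^ (2 * k) * ((((I.basis.det : ℤ) : ℝ) ^ 2) ^ k * (2 * lam) ^ k) := by
          gcongr
      _ = ((100 * ((d.num : ℤ) : ℝ)) ^ 2 * (2 * lam)) ^ k * (((I.basis.det : ℤ) : ℝ) ^ 2) ^ k := by
          have key : ∀ (P D2 T : ℝ) (k : ℕ), P ^ (2 * k) * (D2 ^ k * T ^ k) = (P ^ 2 * T) ^ k * D2 ^ k := by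
            intro P D2 T k; rw [mul_pow, ← pow_mul]; ring
          exact key _ _ _ _
      _ ≤ (4 * (N : ℝ) * ((d.den : ℕ) : ℝ) ^ 2) ^ k * (((I.basis.det : ℤ) : ℝ) ^ 2) ^ k :=
          mul_le_mul_of_nonneg_right (pow_le_pow_left₀ (by positivity) hΛ k) (by positivity)
      _ = (4 * (N : ℝ) * (((d.den : ℕ) : ℝ) * ((I.basis.det : ℤ) : ℝ)) ^ 2) ^ k := by
          rw [← mul_pow]; congr 1; ring
  have hR' := hR
  rw [← hcastTr] at hR'
  have hfinal : (((100 * d.num) ^ (2 * k) * Matrix.trace (((certOf I t ω).sampleMat * (certOf I t ω).sampleMatᵀ) ^ k) : ℤ) : ℝ) ≤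
      (((4 * (N : ℤ) * ((d.den : ℤ) * (certOf I t ω).D) ^ 2) ^ k : ℤ) : ℝ) := by
    push_cast
    have hDdef : (((certOf I t ω).D : ℤ) : ℝ) = ((I.basis.det : ℤ) : ℝ) := rfl
    rw [hDdef]
    exact hR'
  exact_mod_cast hfinal

/-- **Acceptance of the built certificate** from the two sample properties (check 3 and check 5
inputs); checks 1, 2 and 4's format are automatic (`det B ≠ 0`, `B · adj B = det B · 1`, nearest
integers by `round`). [cite: AharonovRegev2005, §6.2 (p. 11) — variant] -/
theorem accepts_certOf (hI : I.IsNonsingular) (t : Fin I.n → ℤ) {d : ℚ} (hd : 0 < d)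
    (ω : Fin (nSamples I.n) → dualLattice I.lattice)
    (h3 : (nSamples I.n : ℝ) / 50 ≤ ∑ j, distInt ⟪intVecToEuclidean I.n t, (ω j : EuclideanSpace ℝ (Fin I.n))⟫_ℝ ^ 2)
    {lam : ℝ} (hlam0 : 0 ≤ lam) (hlam : lam ≤ 2 * (nSamples I.n) * ((d.den : ℕ) : ℝ) ^ 2 / (100 * ((d.num : ℤ) : ℝ)) ^ 2)
    (hop : ∀ u : EuclideanSpace ℝ (Fin I.n), ∑ j, ⟪u, (ω j : EuclideanSpace ℝ (Fin I.n))⟫_ℝ ^ 2 ≤ lam * ‖u‖ ^ 2) :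
    Accepts I.basis t d (certOf I t ω) := by
  refine ⟨hI, ?_, fun j ↦ two_mul_residual_certOf_le t ω j, check3_certOf t ω h3, check5_certOf t hd ω hlam0 hlam hop⟩
  exact Matrix.mul_adjugate I.basis


/-! ### Numerical constants -/

/-- `√(2πe) ≤ 5`. [folklore] -/
theorem sqrt_two_pi_e_le_five : Real.sqrt (2 * π * Real.exp 1) ≤ 5 := by
  have hπ := Real.pi_lt_d2
  have he := Real.exp_one_lt_d9
  rw [Real.sqrt_le_left (by norm_num)]
  nlinarith [Real.pi_pos, Real.exp_pos 1]

/-- `e^{-m} ≤ 2^{-k}` whenever `2^k ≤ 2.718^m`. [folklore] -/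
theorem exp_neg_le_two_pow {m k : ℕ} (h : (2 : ℝ) ^ k ≤ (2.718 : ℝ) ^ m) : Real.exp (-(m : ℝ)) ≤ (2⁻¹ : ℝ) ^ k := by
  have he := Real.exp_one_gt_d9
  have h1 : (2.718 : ℝ) ^ m ≤ Real.exp (m : ℝ) := by
    rw [← Real.exp_one_pow]
    exact pow_le_pow_left₀ (by norm_num) (by linarith) m
  rw [Real.exp_neg, inv_pow, inv_eq_one_div, inv_eq_one_div, div_le_div_iff_of_pos_left one_pos (Real.exp_pos _) (by positivity)]
  exact h.trans h1

/-- The constant of AR Lemma 3.1 with `c = 2`: `2√(2πe) e^{-4π} ≤ 2⁻¹³`. [folklore] -/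
theorem const_two_le : 2 * Real.sqrt (2 * π * Real.exp 1) * Real.exp (-π * 2 ^ 2) ≤ (2⁻¹ : ℝ) ^ 13 := by
  have h1 := sqrt_two_pi_e_le_five
  have h2 : Real.exp (-π * 2 ^ 2) ≤ Real.exp (-(12 : ℕ)) := Real.exp_le_exp.2 (by have := Real.pi_gt_three; push_cast; nlinarith)
  have h3 : Real.exp (-((12 : ℕ) : ℝ)) ≤ (2⁻¹ : ℝ) ^ 17 := exp_neg_le_two_pow (by norm_num)
  calc 2 * Real.sqrt (2 * π * Real.exp 1) * Real.exp (-π * 2 ^ 2) ≤ 2 * 5 * (2⁻¹ : ℝ) ^ 17 := by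
        gcongr
        exact h2.trans h3
    _ ≤ (2⁻¹ : ℝ) ^ 13 := by norm_num

/-- The tail constant with `c = 3`: `3√(2πe) e^{-9π} ≤ 2⁻³⁴`. [folklore] -/
theorem const_three_le : 3 * Real.sqrt (2 * π * Real.exp 1) * Real.exp (-π * 3 ^ 2) ≤ (2⁻¹ : ℝ) ^ 34 := by
  have h1 := sqrt_two_pi_e_le_five
  have h2 : Real.exp (-π * 3 ^ 2) ≤ Real.exp (-(28 : ℕ)) := Real.exp_le_exp.2 (by have := Real.pi_gt_d2; push_cast; nlinarith)
  have h3 : Real.exp (-((28 : ℕ) : ℝ)) ≤ (2⁻¹ : ℝ) ^ 38 := exp_neg_le_two_pow (by norm_num)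
  calc 3 * Real.sqrt (2 * π * Real.exp 1) * Real.exp (-π * 3 ^ 2) ≤ 3 * 5 * (2⁻¹ : ℝ) ^ 38 := by
        gcongr
        exact h2.trans h3
    _ ≤ (2⁻¹ : ℝ) ^ 34 := by norm_num

/-- `(n+1)⁴ ≤ 2^{4n}` for `n ≥ 1`. [folklore] -/
theorem succ_pow_four_le (n : ℕ) (hn : 1 ≤ n) : ((n : ℝ) + 1) ^ 4 ≤ (2 : ℝ) ^ (4 * n) := by
  have h : (n : ℝ) + 1 ≤ (2 : ℝ) ^ n := by exact_mod_cast Nat.succ_le_of_lt Nat.lt_two_pow_self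
  calc ((n : ℝ) + 1) ^ 4 ≤ ((2 : ℝ) ^ n) ^ 4 := pow_le_pow_left₀ (by positivity) h 4
    _ = 2 ^ (4 * n) := by rw [← pow_mul, mul_comm]

/-- First budget term: `3000 (n+1)⁴ (2⁻³⁴)ⁿ ≤ 1/100` for `n ≥ 1`. [folklore] -/
theorem budget_term1 (n : ℕ) (hn : 1 ≤ n) : 3000 * ((n : ℝ) + 1) ^ 4 * ((2⁻¹ : ℝ) ^ 34) ^ n ≤ 1 / 100 := by
  have h1 := succ_pow_four_le n hn
  have h2 : ((2⁻¹ : ℝ) ^ 34) ^ n = (2⁻¹ : ℝ) ^ (34 * n) := by rw [← pow_mul]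
  rw [h2]
  have h3 : (2 : ℝ) ^ (4 * n) * (2⁻¹ : ℝ) ^ (34 * n) = (2⁻¹ : ℝ) ^ (30 * n) := by
    rw [show 34 * n = 4 * n + 30 * n by ring, pow_add, ← mul_assoc, inv_pow, inv_pow, mul_inv_cancel₀ (by positivity), one_mul]
  have h4 : (2⁻¹ : ℝ) ^ (30 * n) ≤ (2⁻¹ : ℝ) ^ 30 := pow_le_pow_of_le_one (by norm_num) (by norm_num) (by omega)
  calc 3000 * ((n : ℝ) + 1) ^ 4 * (2⁻¹ : ℝ) ^ (34 * n) ≤ 3000 * (2 : ℝ) ^ (4 * n) * (2⁻¹ : ℝ) ^ (34 * n) := by gcongr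
    _ = 3000 * (2⁻¹ : ℝ) ^ (30 * n) := by rw [mul_assoc, h3]
    _ ≤ 3000 * (2⁻¹ : ℝ) ^ 30 := by gcongr
    _ ≤ 1 / 100 := by norm_num

/-! ### NO instances have accepted certificates -/

/-- **The probability budget is met by `nSamples`**: for `n ≥ 1`, `s > 0`, `N = 3000 (n+1)⁴`, with
tail constant `c = 3`, deviation `a = N/100` and level `√θ = N/(2s²)`, the three failure bounds of
`exists_good_dualSamples` sum to less than `1` (`≤ 1/100 + 53/1000 + 108/1000`). Stated literally in the
shape of that hypothesis for `V = ℝⁿ`, `ι = Fin n`. [folklore] -/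
theorem budget_lt_one {n : ℕ} (hn : 1 ≤ n) {s : ℝ} (hs0 : 0 < s) :
    (nSamples n : ℝ) * (3 * Real.sqrt (2 * π * Real.exp 1) * Real.exp (-π * 3 ^ 2)) ^ finrank ℝ (EuclideanSpace ℝ (Fin n)) +
        (nSamples n : ℝ) * (1 / 4) ^ 2 / (4 * ((nSamples n : ℝ) / 100) ^ 2) +
        (nSamples n : ℝ) * Fintype.card (Fin n × Fin n) *
            ((3 * s⁻¹ * Real.sqrt (finrank ℝ (EuclideanSpace ℝ (Fin n)))) ^ 2) ^ 2 /
          ((nSamples n : ℝ) / (2 * s ^ 2)) ^ 2 < 1 := by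
  rw [finrank_euclideanSpace_fin, Fintype.card_prod, Fintype.card_fin]
  have hN0 : (0 : ℝ) < nSamples n := by exact_mod_cast nSamples_pos n
  have hN3 : (3000 : ℝ) ≤ nSamples n := by exact_mod_cast le_nSamples n
  have hN4 : 3000 * (n : ℝ) ^ 4 ≤ nSamples n := by exact_mod_cast pow_four_le_nSamples n
  -- term 1
  have h1 : (nSamples n : ℝ) * (3 * Real.sqrt (2 * π * Real.exp 1) * Real.exp (-π * 3 ^ 2)) ^ n ≤ 1 / 100 := by
    have hC0 : 0 ≤ 3 * Real.sqrt (2 * π * Real.exp 1) * Real.exp (-π * 3 ^ 2) := by positivity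
    calc (nSamples n : ℝ) * (3 * Real.sqrt (2 * π * Real.exp 1) * Real.exp (-π * 3 ^ 2)) ^ n
        ≤ (nSamples n : ℝ) * ((2⁻¹ : ℝ) ^ 34) ^ n := by gcongr; exact const_three_le
      _ = 3000 * ((n : ℝ) + 1) ^ 4 * ((2⁻¹ : ℝ) ^ 34) ^ n := by rw [cast_nSamples]
      _ ≤ 1 / 100 := budget_term1 n hn
  -- term 2
  have h2 : (nSamples n : ℝ) * (1 / 4) ^ 2 / (4 * ((nSamples n : ℝ) / 100) ^ 2) ≤ 53 / 1000 := by
    rw [div_le_iff₀ (by positivity)]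
    nlinarith
  -- term 3
  have h3 : (nSamples n : ℝ) * ((n * n : ℕ) : ℝ) * ((3 * s⁻¹ * Real.sqrt (n : ℝ)) ^ 2) ^ 2 /
      ((nSamples n : ℝ) / (2 * s ^ 2)) ^ 2 ≤ 108 / 1000 := by
    have hsq : Real.sqrt (n : ℝ) ^ 2 = n := Real.sq_sqrt (Nat.cast_nonneg _)
    have hval : (nSamples n : ℝ) * ((n * n : ℕ) : ℝ) * ((3 * s⁻¹ * Real.sqrt (n : ℝ)) ^ 2) ^ 2 /
        ((nSamples n : ℝ) / (2 * s ^ 2)) ^ 2 = 324 * (n : ℝ) ^ 4 / nSamples n := by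
      push_cast
      rw [mul_pow, mul_pow, hsq]
      field_simp
      ring
    rw [hval, div_le_iff₀ hN0]
    nlinarith
  linarith

/-- **AR Lemma 3.1 for a NO instance**: if every lattice point is at distance `≥ 2 s √n` from `t`
then `f_s(t) = ρ_s(L − t)/ρ_s(L) ≤ 2⁻¹³` (`n ≥ 1`). [cite: AharonovRegev2005, Lemma 3.1 (p. 8) — variant] -/
theorem fRatio_le {I : LatticeInstance} [IsZLattice ℝ I.lattice] (hn : 1 ≤ I.n) {s : ℝ} (hs0 : 0 < s)
    (x : EuclideanSpace ℝ (Fin I.n))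
    (hfar : ∀ y : I.lattice, 2 * s * Real.sqrt (finrank ℝ (EuclideanSpace ℝ (Fin I.n))) ≤ ‖(y : EuclideanSpace ℝ (Fin I.n)) - x‖) :
    (∑' y : I.lattice, gaussianFunction s ((y : EuclideanSpace ℝ (Fin I.n)) - x)) /
        (∑' y : I.lattice, gaussianFunction s (y : EuclideanSpace ℝ (Fin I.n))) ≤ (2⁻¹ : ℝ) ^ 13 := by
  have hc2 : 1 / Real.sqrt (2 * π) ≤ 2 := by
    rw [div_le_iff₀ (Real.sqrt_pos.2 (by positivity))]
    have : (1 : ℝ) ≤ Real.sqrt (2 * π) := Real.one_le_sqrt.2 (by linarith [Real.pi_gt_three])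
    linarith
  have hZ : 0 < ∑' y : I.lattice, gaussianFunction s (y : EuclideanSpace ℝ (Fin I.n)) := by
    have := tsum_gaussianFunction_sub_pos I.lattice hs0.ne' (0 : EuclideanSpace ℝ (Fin I.n))
    simpa only [sub_zero] using this
  have h31 := tsum_gaussianFunction_sub_le_pow_mul_of_forall_le I.lattice hs0 hc2 hfar
  rw [div_le_iff₀ hZ]
  refine h31.trans (mul_le_mul_of_nonneg_right ?_ hZ.le)
  have hC0 : 0 ≤ 2 * Real.sqrt (2 * π * Real.exp 1) * Real.exp (-π * 2 ^ 2) := by positivity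
  have hC1 : 2 * Real.sqrt (2 * π * Real.exp 1) * Real.exp (-π * 2 ^ 2) ≤ 1 := const_two_le.trans (by norm_num)
  rw [finrank_euclideanSpace_fin]
  calc (2 * Real.sqrt (2 * π * Real.exp 1) * Real.exp (-π * 2 ^ 2)) ^ I.n
      ≤ (2 * Real.sqrt (2 * π * Real.exp 1) * Real.exp (-π * 2 ^ 2)) ^ 1 := pow_le_pow_of_le_one hC0 hC1 hn
    _ ≤ (2⁻¹ : ℝ) ^ 13 := by rw [pow_one]; exact const_two_le

/-- The two inequalities between the constants that the assembly needs: `N/50 ≤ N((1 − 2⁻¹³)/(2π²)) − N/100`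
and `N(π/8 + 1/2) ≤ 2N`. [folklore] -/
theorem const_ineqs {Nr : ℝ} (hN : 0 ≤ Nr) :
    Nr / 50 ≤ Nr * ((1 - (2⁻¹ : ℝ) ^ 13) / (2 * π ^ 2)) - Nr / 100 ∧ Nr * (π / 8 + 1 / 2) ≤ 2 * Nr := by
  have hπ : π ^ 2 ≤ 10 := by have := Real.pi_lt_d2; have := Real.pi_pos; nlinarith
  have hπ4 : π < 4 := by linarith [Real.pi_lt_d2]
  have hπ0 : 0 < 2 * π ^ 2 := by positivity
  have hkey : (1 : ℝ) / 50 + 1 / 100 ≤ (1 - (2⁻¹ : ℝ) ^ 13) / (2 * π ^ 2) := by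
    rw [le_div_iff₀ hπ0]; nlinarith
  constructor
  · nlinarith [mul_le_mul_of_nonneg_left hkey hN]
  · nlinarith

/-- **Completeness at the level of mathematics** (AR05 §6.2 for the integer variant): for a NO
instance of `GapCVP_{200√n}` — `B` nonsingular, `d > 0`, `dist(t, L(B)) > 200 √n d` — some dual
sample tuple `ω` (drawn from `D_{L(B)*, 1/(100d)}`; here: shown to exist) yields an ACCEPTED
certificate `certOf I t ω`. Ingredients: AR Lemma 3.1 (`fRatio_le`), good tuples
(`exists_good_dualSamples`, `DualGaussianSampling.lean`, budget `budget_lt_one`), the operator bound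
(`sum_inner_sq_le_of_good`: `λ = N(π/8 + 1/2)/s² ≤ 2N/s²`), and `accepts_certOf`.
[cite: AharonovRegev2005, §6.2 (Completeness, pp. 11–12) — variant] -/
theorem exists_accepts_of_far {t : Fin I.n → ℤ} {d : ℚ}
    (hp : ((⟨I, t⟩ : CVPInstance), d) ∈ GapCVP.no (fun n ↦ 200 * Real.sqrt n)) :
    ∃ ω : Fin (nSamples I.n) → dualLattice I.lattice, Accepts I.basis t d (certOf I t ω) := by
  obtain ⟨hI, hd, hfar⟩ := hp
  change (200 * Real.sqrt (I.n : ℝ)) * (d : ℝ) < infDist (intVecToEuclidean I.n t) (I.lattice : Set (EuclideanSpace ℝ (Fin I.n))) at hfar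
  -- positive dimension
  have hn : 1 ≤ I.n := by
    by_contra h0
    have h00 : I.n = 0 := by omega
    have hz := infDist_targetE_eq_zero_of_n_eq_zero (c := (⟨I, t⟩ : CVPInstance)) h00
    change infDist (intVecToEuclidean I.n t) (I.lattice : Set (EuclideanSpace ℝ (Fin I.n))) = 0 at hz
    rw [hz, h00, Nat.cast_zero, Real.sqrt_zero, mul_zero, zero_mul] at hfar
    exact lt_irrefl _ hfar
  haveI : IsZLattice ℝ I.lattice := LatticeInstance.isZLattice_of_isNonsingular hI
  have hdR : (0 : ℝ) < d := by exact_mod_cast hd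
  obtain ⟨s, hs⟩ : ∃ s : ℝ, s = 100 * d := ⟨_, rfl⟩
  have hs0 : 0 < s := by rw [hs]; positivity
  have hN0 : (0 : ℝ) < nSamples I.n := by exact_mod_cast nSamples_pos I.n
  -- AR Lemma 3.1 input: every lattice point is `≥ 2 s √n` away
  have hfarall : ∀ y : I.lattice, 2 * s * Real.sqrt (finrank ℝ (EuclideanSpace ℝ (Fin I.n))) ≤
      ‖(y : EuclideanSpace ℝ (Fin I.n)) - intVecToEuclidean I.n t‖ := by
    intro y
    rw [finrank_euclideanSpace_fin]
    have h1 : infDist (intVecToEuclidean I.n t) (I.lattice : Set (EuclideanSpace ℝ (Fin I.n))) ≤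
        dist (intVecToEuclidean I.n t) y := infDist_le_dist_of_mem y.2
    rw [dist_eq_norm, ← norm_neg, neg_sub] at h1
    have : 2 * s * Real.sqrt (I.n : ℝ) = 200 * Real.sqrt (I.n : ℝ) * d := by rw [hs]; ring
    linarith
  have hf := fRatio_le hn hs0 (intVecToEuclidean I.n t) hfarall
  -- good samples
  have hc3 : 1 / Real.sqrt (2 * π) ≤ 3 := by
    rw [div_le_iff₀ (Real.sqrt_pos.2 (by positivity))]
    have : (1 : ℝ) ≤ Real.sqrt (2 * π) := Real.one_le_sqrt.2 (by linarith [Real.pi_gt_three])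
    linarith
  have ha : (0 : ℝ) < (nSamples I.n : ℝ) / 100 := by positivity
  have hθ : (0 : ℝ) < ((nSamples I.n : ℝ) / (2 * s ^ 2)) ^ 2 := by positivity
  obtain ⟨ω, hω1, hω2, hω3⟩ := exists_good_dualSamples I.lattice hs0 hc3 ha hθ (intVecToEuclidean I.n t)
    (EuclideanSpace.basisFun (Fin I.n) ℝ) (nSamples I.n) (budget_lt_one hn hs0)
  have hR0 : 0 < 3 * s⁻¹ * Real.sqrt (finrank ℝ (EuclideanSpace ℝ (Fin I.n))) := by
    rw [finrank_euclideanSpace_fin]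
    have : 0 < Real.sqrt (I.n : ℝ) := Real.sqrt_pos.2 (by exact_mod_cast hn)
    positivity
  -- the operator bound from the good tuple
  have hop : ∀ u : EuclideanSpace ℝ (Fin I.n), ∑ j, ⟪u, (ω j : EuclideanSpace ℝ (Fin I.n))⟫_ℝ ^ 2 ≤
      ((nSamples I.n : ℝ) * (π / (8 * s ^ 2)) + Real.sqrt (((nSamples I.n : ℝ) / (2 * s ^ 2)) ^ 2)) * ‖u‖ ^ 2 :=
    sum_inner_sq_le_of_good I.lattice hs0 hR0 (EuclideanSpace.basisFun (Fin I.n) ℝ) (fun j ↦ (hω1 j).le) hω3.le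
  obtain ⟨hk1, hk2⟩ := const_ineqs hN0.le
  refine ⟨ω, accepts_certOf hI t hd ω ?_ (by positivity) ?_ hop⟩
  · -- check 3 input: `N/50 ≤ ∑ distInt²`
    have hmono : (nSamples I.n : ℝ) * ((1 - (2⁻¹ : ℝ) ^ 13) / (2 * π ^ 2)) ≤
        (nSamples I.n : ℝ) * ((1 - (∑' y : I.lattice, gaussianFunction s ((y : EuclideanSpace ℝ (Fin I.n)) - intVecToEuclidean I.n t)) /
          ∑' y : I.lattice, gaussianFunction s (y : EuclideanSpace ℝ (Fin I.n))) / (2 * π ^ 2)) :=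
      mul_le_mul_of_nonneg_left (div_le_div_of_nonneg_right (by linarith) (by positivity)) hN0.le
    linarith
  · -- `λ ≤ 2 N q²/(100 p)²`
    rw [Real.sqrt_sq (by positivity)]
    have hdq : (d : ℝ) * ((d.den : ℕ) : ℝ) = ((d.num : ℤ) : ℝ) := by exact_mod_cast Rat.mul_den_eq_num d
    have hq0 : (0 : ℝ) < ((d.den : ℕ) : ℝ) := by exact_mod_cast d.den_pos
    have hs2 : 2 * (nSamples I.n : ℝ) * ((d.den : ℕ) : ℝ) ^ 2 / (100 * ((d.num : ℤ) : ℝ)) ^ 2 = 2 * (nSamples I.n : ℝ) / s ^ 2 := by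
      rw [← hdq, hs]; field_simp
    have hlhs : (nSamples I.n : ℝ) * (π / (8 * s ^ 2)) + (nSamples I.n : ℝ) / (2 * s ^ 2) =
        (nSamples I.n : ℝ) * (π / 8 + 1 / 2) / s ^ 2 := by field_simp
    rw [hs2, hlhs, div_le_div_iff_of_pos_right (by positivity)]
    exact hk2

end ARVerifier

end Literature.Algebra.EuclideanLattices

end
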